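import Summits.QuantumFields.BalabanUV.Beta.EriceRemainderEnclosureHistoryAutonomyComparisonDefectPseudoOrbit

/-!
# EriceRemainderEnclosureHistoryAutonomyComparisonDefectRunEnclosure — (E140j) **THE ENCLOSURE READ ON A RUN OF THE PRINTED RECURSION SHAPE (0.20).**  A run
# `RGEqH K β g` of node U2's history-dependent recursion `1∕g_k² = 1∕g_{k+1}² + β_{k+1}(g_0, …, g_k)` (`k < K`; `FlowStep.RGEqH`, the statement-level shape of
# [I] (0.20) p. 256 with the history dependence of p. 298 — a SHAPE, nothing of Bałaban's β asserted), read from its infrared end (`h′_j = g_{K−j}`, `j ≤ K`) and continued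
# into the ultraviolet by any box sequence, IS an `ε`-pseudo-orbit of a structured memory `B` as soon as **each `β_{k+1}(g_0, …, g_k)` is within `ε` of `B` read on the
# reversed, continued history `(g_k, g_{k−1}, …, g_0, …)`** and the continuation's own increments are within `ε` of `B`.  Hence (E140i) `pseudo_orbit_enclosure`:
# **`1∕h₋_j² − c ≤ 1∕g_{K−j}² ≤ 1∕h₊_j² + c` for `j ≤ K`, `c = (K_mem−1)·θ·2ε∕(1−θ)`** (`run_enclosure_at`), `h₋, h₊` the orbits of `B ∓ ε` from the run's infrared value `g_K`,
# `K_mem` the number of ages of `B`'s profile — DEPTH-INDEPENDENT: the same constant for every `K`.  This is the column's enclosure in the currency the β-flow team's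
# AS-PRINTED files use (`RGEqH` runs), under a closeness hypothesis of node U2's `ScaleShiftRate` TYPE (there: `|β_k(revHist h k) − betaInf β h| ≤ cθ^k∕(1−θ)`).

Cell `pub-balaban`, β-function sub-cell, BINDER row D4 «RemainderConst leaves for Bałaban's split» (`HOME/BINDER-OWNERS.md`; owner lineage `b2b-balaban-beta-an4`;
this file by co-owner #2 lineage `b2b-balaban-beta-d4-p2`, generation 108), β-FLOW TEAM duty (1), FREEZE (0) honoured (def-free; node U2's `FlowStep.RGEqH` ∕ `prefixOf` and
(E140i) `pseudo_orbit_enclosure` BY NAME; nothing restated).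

HONEST FRAMING (page 1, verbatim and binding).  *"Discharging BetaPertH makes Bałaban's UV stability UNCONDITIONAL — a real constructive-QFT result; it is
NOT the continuum limit and NOT the Clay problem."*  THIS FILE DISCHARGES NOTHING OF THE KIND.  Elementary bookkeeping (index reversal) over node U2's typed
HYPOTHESIS SHAPES; whether Bałaban's β_{k+1} (1.22) are `ε`-close to one structured (isotone, level-Lipschitz, `θ < 1`) functional is NOT PRINTED ([I] p. 298; GAPS
G-t4-U2-1∕-2) and NOT asserted; the continuation beyond the bare end is the user's datum.  Row D4 class UNCHANGED (critical-path width 0; instance 0∕1; D4 DISCHARGE NO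
DATE).  NOT B12 Thm 2, NOT BetaPertH, NOT continuum YM, NOT Clay.

WHAT IS PROVED ([folklore]; 0 `def`, 0 sorry).  `run_increment`, **`run_enclosure`**, **`run_enclosure_at`**.
-/

noncomputable section
open Finset Set

namespace Summit.QuantumFields.BalabanUV.Beta.EriceRemainderEnclosureHistoryAutonomyComparisonDefectRunEnclosure

open Literature.MathematicalPhysics.QuantumFieldTheory.Balaban1983to89
open Literature.MathematicalPhysics.QuantumFieldTheory.Balaban1983to89.FlowStep (HBeta prefixOf RGEqH)
open Literature.MathematicalPhysics.QuantumFieldTheory.Balaban1983to89.T4BetaStationary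
open Literature.MathematicalPhysics.QuantumFieldTheory.Balaban1983to89.T4BetaFlowWellPosed
open Summit.QuantumFields.BalabanUV.Beta.EriceRemainderEnclosureHistoryAutonomyComparisonDefectPseudoOrbit (pseudo_orbit_enclosure)

variable {B : (ℕ → ℝ) → ℝ} {M γ b : ℝ} {β : HBeta} {g h' hlo hup : ℕ → ℝ} {K : ℕ}

/-- THE INCREMENT OF THE REVERSED RUN IS THE PRINTED β-VALUE: for a run `RGEqH K β g` and `h′_j = g_{K−j}` (`j ≤ K`), at every `m < K`
`1∕h′_{m+1}² − 1∕h′_m² = β_{k+1}(g_0, …, g_k)` with `k = K − m − 1`, and the tail `(h′_{m+1+j})_j` starts `(g_k, g_{k−1}, …)`. [folklore] -/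
theorem run_increment (hrun : RGEqH K β g) (hrev : ∀ j, j ≤ K → h' j = g (K - j)) {m : ℕ} (hm : m < K) :
    1 / h' (m + 1) ^ 2 - 1 / h' m ^ 2 = β (K - m - 1) (prefixOf g (K - m - 1)) := by
  obtain ⟨k, hk⟩ : ∃ k, k = K - m - 1 := ⟨_, rfl⟩
  have hkK : k < K := by omega
  have hstep := hrun k hkK
  have e1 : K - (m + 1) = k := by omega
  have e2 : K - m = k + 1 := by omega
  rw [hrev (m + 1) (by omega), hrev m (by omega), ← hk, e1, e2]
  linarith

/-- **RUN ENCLOSURE.**  `B`: isotone on the box `]0,γ]^ℕ`, zeroth moment `M`, floor `b`, `B ≤ β̄`, level-Lipschitz age profile `Λ ≥ 0` on `range Kmem` over the box graded by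
`b − ε`, `θ := Σ_{k<Kmem} k·Λ_k < 1`.  A run `RGEqH K β g` of the history-dependent recursion; `h′` ANY box sequence with `h′_j = g_{K−j}` for `j ≤ K` (the run read from its
infrared end, CONTINUED into the ultraviolet beyond `j = K` by the user's choice); closeness: **`|β_{k+1}(g_0, …, g_k) − B(h′_{K−k}, h′_{K−k+1}, …)| ≤ ε` for `k < K`** (each printed
β-value within `ε` of the structured memory read on the reversed, continued history) and the continuation's increments within `ε` of `B` (`m ≥ K`); `0 ≤ ε < b`; `h₋, h₊`
box solutions of `B − ε`, `B + ε` from the infrared value `h′_0 = g_K`.  Then with `c := (Kmem−1)·θ·2ε∕(1−θ)`, for EVERY `j`:  `1∕h₋_j² − c ≤ 1∕h′_j² ≤ 1∕h₊_j² + c` —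
(E140i) `pseudo_orbit_enclosure`. [folklore] -/
theorem run_enclosure {Λ : ℕ → ℝ} {Kmem : ℕ} {βb p ε : ℝ}
    (hmono : ∀ u v : ℕ → ℝ, SeqBox γ u → SeqBox γ v → (∀ i, u i ≤ v i) → B u ≤ B v)
    (hB : ∀ u u' : ℕ → ℝ, SeqBox γ u → SeqBox γ u' → ∀ D : ℝ, (∀ j, |u j - u' j| ≤ D) → |B u - B u'| ≤ M * D) (hM : 0 ≤ M)
    (hε : 0 ≤ ε) (hεb : ε < b) (hlow : ∀ u, SeqBox γ u → b ≤ B u) (hbdd : ∀ u, SeqBox γ u → B u ≤ βb)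
    (hΛ : ∀ k, 0 ≤ Λ k) (hθ : ∑ k ∈ range Kmem, (k : ℝ) * Λ k < 1)
    (hLip : ∀ u v : ℕ → ℝ, SeqBox γ u → SeqBox γ v → (∀ k : ℕ, 1 / γ ^ 2 + ((k : ℝ) + 1) * (b - ε) ≤ 1 / u k ^ 2) →
      (∀ k : ℕ, 1 / γ ^ 2 + ((k : ℝ) + 1) * (b - ε) ≤ 1 / v k ^ 2) → B u - B v ≤ ∑ k ∈ range Kmem, Λ k * max (1 / v k ^ 2 - 1 / u k ^ 2) 0)
    (hp : 0 < p) (hpγ : p ≤ γ) (hhlo : SeqBox γ hlo) (hflo : MemFlow (fun w => B w + -ε) p hlo)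
    (hhup : SeqBox γ hup) (hfup : MemFlow (fun w => B w + ε) p hup)
    (hrun : RGEqH K β g) (hh' : SeqBox γ h') (hp0 : h' 0 = p) (hrev : ∀ j, j ≤ K → h' j = g (K - j))
    (hclose : ∀ k, k < K → |β k (prefixOf g k) - B (fun j => h' (K - k + j))| ≤ ε)
    (hcont : ∀ m, K ≤ m → |1 / h' (m + 1) ^ 2 - 1 / h' m ^ 2 - B (fun j => h' (m + 1 + j))| ≤ ε) (j : ℕ) :
    1 / hlo j ^ 2 - ((Kmem - 1 : ℕ) : ℝ) * ((∑ k ∈ range Kmem, (k : ℝ) * Λ k) * (2 * ε) / (1 - ∑ k ∈ range Kmem, (k : ℝ) * Λ k)) ≤ 1 / h' j ^ 2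
      ∧ 1 / h' j ^ 2 ≤ 1 / hup j ^ 2 + ((Kmem - 1 : ℕ) : ℝ) * ((∑ k ∈ range Kmem, (k : ℝ) * Λ k) * (2 * ε) / (1 - ∑ k ∈ range Kmem, (k : ℝ) * Λ k)) := by
  refine pseudo_orbit_enclosure hmono hB hM hε hεb hlow hbdd hΛ hθ hLip hp hpγ hhlo hflo hhup hfup hh' hp0 (fun m => ?_) j
  rcases lt_or_ge m K with hm | hm
  · rw [run_increment hrun hrev hm]
    have et : (fun j => h' (m + 1 + j)) = (fun j => h' (K - (K - m - 1) + j)) :=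
      funext fun j => by rw [show K - (K - m - 1) = m + 1 by omega]
    rw [et]
    exact hclose (K - m - 1) (by omega)
  · exact hcont m hm

/-- **RUN ENCLOSURE, AT THE RUN'S OWN SCALES**: under the data of `run_enclosure`, for `j ≤ K`
**`1∕h₋_j² − c ≤ 1∕g_{K−j}² ≤ 1∕h₊_j² + c`** — the running coupling `j` scales above the infrared end lies between the shifted structured orbits started at the run's
infrared value, up to the DEPTH-INDEPENDENT level constant `c = (Kmem−1)θ·2ε∕(1−θ)` (the same for every `K`). [folklore] -/
theorem run_enclosure_at {Λ : ℕ → ℝ} {Kmem : ℕ} {βb p ε : ℝ}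
    (hmono : ∀ u v : ℕ → ℝ, SeqBox γ u → SeqBox γ v → (∀ i, u i ≤ v i) → B u ≤ B v)
    (hB : ∀ u u' : ℕ → ℝ, SeqBox γ u → SeqBox γ u' → ∀ D : ℝ, (∀ j, |u j - u' j| ≤ D) → |B u - B u'| ≤ M * D) (hM : 0 ≤ M)
    (hε : 0 ≤ ε) (hεb : ε < b) (hlow : ∀ u, SeqBox γ u → b ≤ B u) (hbdd : ∀ u, SeqBox γ u → B u ≤ βb)
    (hΛ : ∀ k, 0 ≤ Λ k) (hθ : ∑ k ∈ range Kmem, (k : ℝ) * Λ k < 1)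
    (hLip : ∀ u v : ℕ → ℝ, SeqBox γ u → SeqBox γ v → (∀ k : ℕ, 1 / γ ^ 2 + ((k : ℝ) + 1) * (b - ε) ≤ 1 / u k ^ 2) →
      (∀ k : ℕ, 1 / γ ^ 2 + ((k : ℝ) + 1) * (b - ε) ≤ 1 / v k ^ 2) → B u - B v ≤ ∑ k ∈ range Kmem, Λ k * max (1 / v k ^ 2 - 1 / u k ^ 2) 0)
    (hp : 0 < p) (hpγ : p ≤ γ) (hhlo : SeqBox γ hlo) (hflo : MemFlow (fun w => B w + -ε) p hlo)
    (hhup : SeqBox γ hup) (hfup : MemFlow (fun w => B w + ε) p hup)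
    (hrun : RGEqH K β g) (hh' : SeqBox γ h') (hp0 : h' 0 = p) (hrev : ∀ j, j ≤ K → h' j = g (K - j))
    (hclose : ∀ k, k < K → |β k (prefixOf g k) - B (fun j => h' (K - k + j))| ≤ ε)
    (hcont : ∀ m, K ≤ m → |1 / h' (m + 1) ^ 2 - 1 / h' m ^ 2 - B (fun j => h' (m + 1 + j))| ≤ ε) {j : ℕ} (hj : j ≤ K) :
    1 / hlo j ^ 2 - ((Kmem - 1 : ℕ) : ℝ) * ((∑ k ∈ range Kmem, (k : ℝ) * Λ k) * (2 * ε) / (1 - ∑ k ∈ range Kmem, (k : ℝ) * Λ k)) ≤ 1 / g (K - j) ^ 2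
      ∧ 1 / g (K - j) ^ 2 ≤ 1 / hup j ^ 2 + ((Kmem - 1 : ℕ) : ℝ) * ((∑ k ∈ range Kmem, (k : ℝ) * Λ k) * (2 * ε) / (1 - ∑ k ∈ range Kmem, (k : ℝ) * Λ k)) := by
  rw [← hrev j hj]
  exact run_enclosure hmono hB hM hε hεb hlow hbdd hΛ hθ hLip hp hpγ hhlo hflo hhup hfup hrun hh' hp0 hrev hclose hcont j

end Summit.QuantumFields.BalabanUV.Beta.EriceRemainderEnclosureHistoryAutonomyComparisonDefectRunEnclosure

end
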